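import Summits.KontsevichZagierPeriods.KontsevichZagierPeriods.Theses.FurushoPentagon
import Summits.KontsevichZagierPeriods.KontsevichZagierPeriods.Theorems.FurushoPentagonReducedPeriodRingDefs
import Summits.KontsevichZagierPeriods.KontsevichZagierPeriods.Theorems.FurushoPentagonSectorToKernelCubeResolutionOfNash
import Summits.KontsevichZagierPeriods.KontsevichZagierPeriods.Theorems.FurushoPentagonSectorToKernelOfLeaves
import Literature.NumberTheory.Transcendental.KZCubicalCalculus
import Literature.NumberTheory.Transcendental.KZProductIdeal

/-!
# `SectorToKernel`, line `effective-cube-surjection`: resolved combinations form a (non-unital) subring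

Crux `FurushoPentagon.SectorToKernel` (stmt-KontsevichZagierPeriods-10813). Call a formal combination
`c : KZ.FormalRep` RESOLVED if it is congruent modulo `KZ.relations` to a `ℤ`-combination of tame cube
classes (`∃ a ∈ cubicalSpan, c - a ∈ relations`); the resolution stub S1 says every representation is
resolved, its landed dimension-one rung (`cubeResolution_dimLEOne`) that every representation of dimension
`≤ 1` is, and `kzKernel_of_ayoubKernel_of_resolved` that Ayoub's effective cube conjecture decides
Conjecture 1 (kernel form) on resolved combinations. This file records that resolved combinations are
closed under the Fubini PRODUCT (`KZ.of_mul_of`: `[r] * [s] = [r × s]`), so that every non-unital subring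
generated by resolved representations — e.g. all polynomial combinations of one-dimensional
representations, reaching `π²`, `(log 2)·π`, … — is resolved:

* `resolvedRing_prod_mem_cubicalGens` — the product of two tame cube classes is a tame cube class;
* `resolvedRing_mul_mem_cubicalSpan` — `cubicalSpan` is closed under `*`;
* `resolved_mul` (registered) — products of resolved combinations are resolved (`KZ.relations` is a
  two-sided ideal, `KZ.mul_sub_mul_mem_relations`);
* `resolved_of_mem_ringClosure` — `NonUnitalSubring.closure` of a resolved family is resolved.

[Kontsevich–Zagier 2001, §4.1; Ayoub 2014, Def. 6, Rem. 12]
-/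

noncomputable section

namespace Summit.KontsevichZagierPeriods.FurushoPentagon.SectorToKernel

open Set MeasureTheory
open Literature.NumberTheory.Transcendental
open Literature.NumberTheory.Transcendental.KZ hiding cubicalSpan
open Summit.KontsevichZagierPeriods.KontsevichZagierPeriods.Theses.FurushoPentagon
open Summit.KontsevichZagierPeriods.FurushoPentagon.ReducedPeriodRing (unitCube cubicalGens cubicalSpan)

/-- `f ⊗ g` is analytic on a neighbourhood of the cube `[0,1]ⁿ⁺ᵐ` when `f`, `g` are analytic near
`[0,1]ⁿ`, `[0,1]ᵐ` (the two coordinate restrictions are continuous linear). [folklore] -/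
theorem resolvedRing_analyticOnNhd_prodFun {n m : ℕ} (r : IntegralRep n) (s : IntegralRep m)
    (hr : AnalyticOnNhd ℝ r.integrand (KZ.cube n)) (hs : AnalyticOnNhd ℝ s.integrand (KZ.cube m)) :
    AnalyticOnNhd ℝ (IntegralRep.prodFun r s) (KZ.cube (n + m)) := by
  let p₁ : (Fin (n + m) → ℝ) →L[ℝ] (Fin n → ℝ) :=
    ContinuousLinearMap.pi fun i => ContinuousLinearMap.proj (Fin.castAdd m i)
  let p₂ : (Fin (n + m) → ℝ) →L[ℝ] (Fin m → ℝ) :=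
    ContinuousLinearMap.pi fun j => ContinuousLinearMap.proj (Fin.natAdd n j)
  have hm₁ : ∀ z ∈ KZ.cube (n + m), p₁ z ∈ KZ.cube n := fun z hz i => by
    simpa [p₁] using hz (Fin.castAdd m i)
  have hm₂ : ∀ z ∈ KZ.cube (n + m), p₂ z ∈ KZ.cube m := fun z hz j => by
    simpa [p₂] using hz (Fin.natAdd n j)
  have h₁ : AnalyticOnNhd ℝ (fun z => r.integrand (p₁ z)) (KZ.cube (n + m)) :=
    hr.comp (p₁.analyticOnNhd _) hm₁
  have h₂ : AnalyticOnNhd ℝ (fun z => s.integrand (p₂ z)) (KZ.cube (n + m)) :=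
    hs.comp (p₂.analyticOnNhd _) hm₂
  have hfun : IntegralRep.prodFun r s = fun z => r.integrand (p₁ z) * s.integrand (p₂ z) := by
    funext z
    simp [IntegralRep.prodFun, p₁, p₂]
  rw [hfun]
  exact h₁.mul h₂

/-- **The product of two tame cube classes is a tame cube class**: `[r] * [s] = [r × s]` with
`r × s` on the cube `[0,1]ⁿ⁺ᵐ` and integrand `f ⊗ g` analytic near it. [Ayoub 2014, Def. 6;
Kontsevich–Zagier 2001, §4.1] -/
theorem resolvedRing_prod_mem_cubicalGens {c d : FormalRep} (hc : c ∈ cubicalGens) (hd : d ∈ cubicalGens) :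
    c * d ∈ cubicalGens := by
  obtain ⟨n, r, hrd, hra, rfl⟩ := hc
  obtain ⟨m, s, hsd, hsa, rfl⟩ := hd
  change r.domain = KZ.cube n at hrd
  change AnalyticOnNhd ℝ r.integrand (KZ.cube n) at hra
  change s.domain = KZ.cube m at hsd
  change AnalyticOnNhd ℝ s.integrand (KZ.cube m) at hsa
  refine ⟨n + m, r.prod s, ?_, ?_, by rw [of_mul_of]⟩
  · change (r.prod s).domain = KZ.cube (n + m)
    rw [IntegralRep.prod_domain, leaves_prodDomain_eq_cube r s hrd hsd]
  · change AnalyticOnNhd ℝ (r.prod s).integrand (KZ.cube (n + m))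
    rw [IntegralRep.prod_integrand_eq]
    exact resolvedRing_analyticOnNhd_prodFun r s hra hsa

/-- **`cubicalSpan` is closed under the product.** [Kontsevich–Zagier 2001, §4.1] -/
theorem resolvedRing_mul_mem_cubicalSpan {a b : FormalRep} (ha : a ∈ cubicalSpan) (hb : b ∈ cubicalSpan) :
    a * b ∈ cubicalSpan := by
  -- first for `b` a generator, by induction on `a`; then induction on `b`
  have hgen : ∀ {a : FormalRep}, a ∈ cubicalSpan → ∀ d ∈ cubicalGens, a * d ∈ cubicalSpan := by
    intro a ha d hd
    induction ha using AddSubgroup.closure_induction with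
    | mem x hx => exact AddSubgroup.subset_closure (resolvedRing_prod_mem_cubicalGens hx hd)
    | zero => rw [zero_mul]; exact cubicalSpan.zero_mem
    | add x y _ _ hx hy => rw [add_mul]; exact cubicalSpan.add_mem hx hy
    | neg x _ hx => rw [neg_mul]; exact cubicalSpan.neg_mem hx
  induction hb using AddSubgroup.closure_induction with
  | mem x hx => exact hgen ha x hx
  | zero => rw [mul_zero]; exact cubicalSpan.zero_mem
  | add x y _ _ hx hy => rw [mul_add]; exact cubicalSpan.add_mem hx hy
  | neg x _ hx => rw [mul_neg]; exact cubicalSpan.neg_mem hx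

/-- **Products of resolved combinations are resolved** (registered stub of line
`effective-cube-surjection`): `KZ.relations` is a two-sided ideal for the Fubini product
(`KZ.mul_sub_mul_mem_relations`) and `cubicalSpan` is multiplicatively closed.
[Kontsevich–Zagier 2001, §4.1; Ayoub 2014, Rem. 12] -/
theorem resolved_mul :
    ∀ c d : FormalRep, (∃ a : FormalRep, a ∈ cubicalSpan ∧ c - a ∈ relations) → (∃ b : FormalRep, b ∈ cubicalSpan ∧ d - b ∈ relations) → ∃ x : FormalRep, x ∈ cubicalSpan ∧ c * d - x ∈ relations := by
  rintro c d ⟨a, ha, hca⟩ ⟨b, hb, hdb⟩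
  exact ⟨a * b, resolvedRing_mul_mem_cubicalSpan ha hb, mul_sub_mul_mem_relations hca hdb⟩

/-- The unit class `[pt, 1]` is resolved (it is a tame cube class). [folklore] -/
theorem resolved_of_unit :
    ∃ a : FormalRep, a ∈ cubicalSpan ∧ of IntegralRep.unit - a ∈ relations :=
  ⟨of IntegralRep.unit, AddSubgroup.subset_closure cubeRes_of_unit_mem_cubicalGens,
    by rw [sub_self]; exact relations.zero_mem⟩

/-- **The non-unital subring generated by a resolved family is resolved.** [folklore] -/
theorem resolved_of_mem_ringClosure (S : Set FormalRep)
    (hS : ∀ d ∈ S, ∃ a : FormalRep, a ∈ cubicalSpan ∧ d - a ∈ relations) :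
    ∀ c ∈ NonUnitalSubring.closure S, ∃ a : FormalRep, a ∈ cubicalSpan ∧ c - a ∈ relations := by
  intro c hc
  induction hc using NonUnitalSubring.closure_induction with
  | mem x hx => exact hS x hx
  | zero => exact ⟨0, cubicalSpan.zero_mem, by simp⟩
  | add x y _ _ hx hy =>
    obtain ⟨a, ha, hxa⟩ := hx
    obtain ⟨b, hb, hyb⟩ := hy
    refine ⟨a + b, cubicalSpan.add_mem ha hb, ?_⟩
    have : x + y - (a + b) = (x - a) + (y - b) := by abel
    rw [this]
    exact relations.add_mem hxa hyb
  | neg x _ hx =>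
    obtain ⟨a, ha, hxa⟩ := hx
    refine ⟨-a, cubicalSpan.neg_mem ha, ?_⟩
    have : -x - -a = -(x - a) := by abel
    rw [this]
    exact relations.neg_mem hxa
  | mul x y _ _ hx hy => exact resolved_mul x y hx hy

end Summit.KontsevichZagierPeriods.FurushoPentagon.SectorToKernel
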